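import Mathlib
import HarnessLib

/-!
# Route `AlmostPrimeZeros`, crux `LinearCappedRepulsion` (stmt-Parity-11327), line
# `jensen-stieltjes-majorant`: Jensen at the free centre, counting form (`stub_jensenCount`)

Pure complex analysis over an arbitrary `P ∈ ℂ[z]` with `P(1) ≠ 0`.  Two majorants of `P` are
given: a DISC majorant `‖P(z)‖ ≤ ‖P(1)‖ exp(Λ Re(z−1) + A(1+‖z−1‖)^{3/2})` on `‖z−1‖ ≤ R₁`
(with the HARMONIC exponent `Λ Re(z−1)`) and a GLOBAL majorant
`‖P(z)‖ ≤ ‖P(1)‖ exp(Λ'(1+‖z−1‖) + B(1+‖z−1‖)^{3/2})`.  With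
`N(t) = #{ρ ∈ roots P : ‖1−ρ‖ ≤ t}` (multiplicity counted) we prove
(a) every root has `‖1 − ρ‖ ≥ e^{−3A}`;
(b) `N(t) ≤ A(1 + et)^{3/2}` for `0 < t`, `et ≤ R₁`;
(c) `N(t) ≤ (Λ + Λ')(1 + et) + B(1 + et)^{3/2}` for all `t > 0`.

Proof.  Jensen's formula for the entire function `z ↦ P(z)` on the circle `‖z − 1‖ = R`
(Mathlib `AnalyticOnNhd.circleAverage_log_norm`; the divisor of a polynomial is its root
multiplicity) reads, in multiset form,
`Σ_{ρ ∈ roots P} log⁺(R/‖1−ρ‖) = circleAverage(log‖P‖, 1, R) − log‖P(1)‖`.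
The circle average of the harmonic term `Λ Re(z − 1)` about the centre `1` vanishes, so a
majorant `‖P(z)‖ ≤ ‖P(1)‖ exp(Λ Re(z−1) + M)` on the circle bounds the left side by `M`
(monotonicity of circle averages; the junk value `log 0 = 0` at roots on the circle is handled by
rescaling `P`, which changes neither the hypothesis nor the roots).  With `R = et` every root with
`‖1−ρ‖ ≤ t` contributes `≥ log e = 1`, giving (b) and (c); with `R = 1` a single root contributes
`log⁺(1/‖1−ρ‖) ≤ 2^{3/2} A ≤ 3A`, giving (a).  No tilt `e^{−Λw}` is needed.

References: the line card `Cruxes/LinearCappedRepulsion/Lines/jensen-stieltjes-majorant`;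
E. C. Titchmarsh, *The Theory of Functions*, 2nd ed., §3.61 (Jensen's formula).
-/

noncomputable section

open Complex Set MeasureTheory Filter Topology Metric Polynomial Real

namespace Summit.Parity.BatemanHorn.Cruxes.LinearCappedRepulsion.JensenStieltjesMajorant

/-- For a non-zero complex polynomial `P` and `a ∈ ℂ`, the order of vanishing of `z ↦ P(z)` at
`a` is the root multiplicity `mult_a(P)`: write `P = (X - a)^m Q` with `Q(a) ≠ 0`. [folklore] -/
private theorem analyticOrderAt_eval_eq_rootMultiplicity {P : ℂ[X]} (hP : P ≠ 0) (a : ℂ) :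
    analyticOrderAt (fun z => P.eval z) a = P.rootMultiplicity a := by
  -- adapted from `analyticOrderAt_eval_polynomial` in
  -- Literature/NumberTheory/EllipticCurves/FunctionFieldEllipticLFormalOrderProofs.lean
  set m := P.rootMultiplicity a with hm
  set Q := P /ₘ (X - C a) ^ m with hQ
  have hdec : (X - C a) ^ m * Q = P := P.pow_mul_divByMonic_rootMultiplicity_eq a
  have hQa : Q.eval a ≠ 0 := eval_divByMonic_pow_rootMultiplicity_ne_zero a hP
  have hfun : (fun z => P.eval z) = ((· - a) ^ m) * fun z => Q.eval z := by
    funext z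
    conv_lhs => rw [← hdec]
    simp [eval_pow]
  have h1 : AnalyticAt ℂ ((· - a) ^ m) a := by fun_prop
  have h2 : AnalyticAt ℂ (fun z => Q.eval z) a := Q.differentiable.analyticAt a
  rw [hfun, analyticOrderAt_mul h1 h2, analyticOrderAt_centeredMonomial,
    h2.analyticOrderAt_eq_zero.mpr hQa, add_zero]

/-- **Jensen's formula for a polynomial, multiset form.**  If `P(1) ≠ 0` and `R > 0` then
`circleAverage (log ‖P‖) 1 R = Σ_{ρ ∈ roots P} log⁺ (R/‖1 − ρ‖) + log ‖P(1)‖`, the sum over the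
roots with multiplicity (Mathlib's Jensen formula `AnalyticOnNhd.circleAverage_log_norm`, with the
divisor of `z ↦ P(z)` identified as the root multiplicity). [folklore] -/
private theorem circleAverage_log_norm_eval {P : ℂ[X]} (h1 : P.eval 1 ≠ 0) {R : ℝ} (hR : 0 < R) :
    Real.circleAverage (fun z => Real.log ‖P.eval z‖) 1 R =
      (P.roots.map fun ρ => Real.posLog (R * ‖1 - ρ‖⁻¹)).sum + Real.log ‖P.eval 1‖ := by
  classical
  have hP : P ≠ 0 := fun h => h1 (by simp [h])
  have hfan : AnalyticOnNhd ℂ (fun z => P.eval z) (closedBall (1 : ℂ) |R|) :=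
    (AnalyticOnNhd.eval_polynomial P).mono (Set.subset_univ _)
  have hJ := hfan.circleAverage_log_norm hR.ne' h1
  rw [hJ]
  congr 1
  have habs : |R| = R := abs_of_pos hR
  set D := MeromorphicOn.divisor (fun z => P.eval z) (closedBall (1 : ℂ) |R|) with hD
  have hDin : ∀ u : ℂ, ‖1 - u‖ ≤ R → D u = P.rootMultiplicity u := by
    intro u hu
    have hmem : u ∈ closedBall (1 : ℂ) |R| := by
      rw [mem_closedBall, dist_eq_norm, norm_sub_rev, habs]; exact hu
    rw [hD, MeromorphicOn.AnalyticOnNhd.divisor_apply hfan hmem,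
      analyticOrderAt_eval_eq_rootMultiplicity hP u]
    simp
  have hDout : ∀ u : ℂ, ¬ ‖1 - u‖ ≤ R → D u = 0 := by
    intro u hu
    apply Function.locallyFinsuppWithin.apply_eq_zero_of_notMem
    rw [mem_closedBall, dist_eq_norm, norm_sub_rev, habs]; exact hu
  have hsupp : Function.support (fun u => (D u : ℝ) * Real.log (R * ‖1 - u‖⁻¹)) ⊆
      ↑P.roots.toFinset := by
    intro u hu
    rw [Function.mem_support] at hu
    have hDu : D u ≠ 0 := fun h => hu (by simp [h])
    have hin : ‖1 - u‖ ≤ R := by_contra fun h => hDu (hDout u h)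
    rw [hDin u hin] at hDu
    have hroot : IsRoot P u :=
      (rootMultiplicity_pos hP).1 (Nat.pos_of_ne_zero (by exact_mod_cast hDu))
    simpa [Multiset.mem_toFinset, mem_roots hP] using hroot
  rw [finsum_eq_sum_of_support_subset _ hsupp, Finset.sum_multiset_map_count]
  refine Finset.sum_congr rfl fun u hu => ?_
  rw [Multiset.mem_toFinset, mem_roots hP] at hu
  have hu1 : u ≠ 1 := by rintro rfl; exact h1 hu
  have hpos : 0 < ‖(1 : ℂ) - u‖ := norm_pos_iff.2 (sub_ne_zero.2 hu1.symm)
  rw [nsmul_eq_mul, count_roots]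
  by_cases hin : ‖1 - u‖ ≤ R
  · rw [hDin u hin, Real.posLog_eq_log]
    · simp
    · rw [abs_of_pos (by positivity), le_mul_inv_iff₀ hpos, one_mul]
      exact hin
  · rw [hDout u hin, (Real.posLog_eq_zero_iff _).2]
    · simp
    · rw [abs_of_pos (by positivity), mul_inv_le_iff₀ hpos, one_mul]
      exact (not_le.1 hin).le

/-- The circle average about the centre `1` of an affine function of the harmonic coordinate
`Re z − 1` is its constant term: `⨍ (a + b (Re z − 1) + m) = a + m` (the average of `cos` over a
period vanishes). [folklore] -/
private theorem circleAverage_affine_re (a b m R : ℝ) :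
    Real.circleAverage (fun z : ℂ => a + b * (z.re - 1) + m) 1 R = a + m := by
  have hre : ∀ θ : ℝ, (circleMap (1 : ℂ) R θ).re - 1 = R * Real.cos θ := by
    intro θ; simp [circleMap, Complex.exp_ofReal_mul_I_re]
  have hint : ∫ θ in (0 : ℝ)..2 * π, (a + b * ((circleMap (1 : ℂ) R θ).re - 1) + m) =
      2 * π * (a + m) := by
    have hfun : ∀ θ : ℝ, a + b * ((circleMap (1 : ℂ) R θ).re - 1) + m =
        (a + m) + (b * R) * Real.cos θ := by
      intro θ; rw [hre]; ring
    simp_rw [hfun]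
    rw [intervalIntegral.integral_add intervalIntegrable_const
        ((Real.continuous_cos.intervalIntegrable _ _).const_mul _),
      intervalIntegral.integral_const, intervalIntegral.integral_const_mul, integral_cos]
    simp [Real.sin_two_pi]
  simp only [Real.circleAverage_def]
  rw [hint, smul_eq_mul, inv_mul_cancel_left₀ (by positivity : (2 * π : ℝ) ≠ 0)]

/-- **Jensen's bound from a tilted majorant, non-degenerate case.**  If `P(1) ≠ 0`, `R > 0`,
`‖P(z)‖ ≤ ‖P(1)‖ exp(Λ Re(z−1) + M)` on the circle `‖z − 1‖ = R`, and the exponent is large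
enough that `log ‖P(1)‖ + Λ Re(z−1) + M ≥ 0` on that circle (so that the junk value `log 0 = 0`
at roots on the circle is harmless), then `Σ_{ρ ∈ roots P} log⁺ (R/‖1−ρ‖) ≤ M`. [folklore] -/
private theorem sum_posLog_le_of_nonneg {P : ℂ[X]} (h1 : P.eval 1 ≠ 0) {R Λ M : ℝ} (hR : 0 < R)
    (hpos : ∀ z : ℂ, ‖z - 1‖ = R → 0 ≤ Real.log ‖P.eval 1‖ + Λ * (z.re - 1) + M)
    (hb : ∀ z : ℂ, ‖z - 1‖ = R → ‖P.eval z‖ ≤ ‖P.eval 1‖ * Real.exp (Λ * (z.re - 1) + M)) :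
    (P.roots.map fun ρ => Real.posLog (R * ‖1 - ρ‖⁻¹)).sum ≤ M := by
  have hfan : AnalyticOnNhd ℂ (fun z => P.eval z) (closedBall (1 : ℂ) |R|) :=
    (AnalyticOnNhd.eval_polynomial P).mono (Set.subset_univ _)
  have hint1 : CircleIntegrable (fun z => Real.log ‖P.eval z‖) 1 R :=
    (hfan.mono sphere_subset_closedBall).meromorphicOn.circleIntegrable_log_norm
  have hcont : Continuous fun z : ℂ => Real.log ‖P.eval 1‖ + Λ * (z.re - 1) + M := by
    fun_prop
  have hint2 : CircleIntegrable (fun z : ℂ => Real.log ‖P.eval 1‖ + Λ * (z.re - 1) + M) 1 R :=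
    hcont.continuousOn.circleIntegrable'
  have hsphere : ∀ z ∈ sphere (1 : ℂ) |R|, ‖z - 1‖ = R := by
    intro z hz
    rw [mem_sphere, dist_eq_norm, abs_of_pos hR] at hz
    exact hz
  have hle : ∀ z ∈ sphere (1 : ℂ) |R|,
      Real.log ‖P.eval z‖ ≤ Real.log ‖P.eval 1‖ + Λ * (z.re - 1) + M := by
    intro z hz
    have hzR := hsphere z hz
    rcases eq_or_ne (P.eval z) 0 with h0 | h0
    · rw [h0, norm_zero, Real.log_zero]
      exact hpos z hzR
    · have hP1 : 0 < ‖P.eval 1‖ := norm_pos_iff.2 h1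
      calc Real.log ‖P.eval z‖
          ≤ Real.log (‖P.eval 1‖ * Real.exp (Λ * (z.re - 1) + M)) :=
            Real.log_le_log (norm_pos_iff.2 h0) (hb z hzR)
        _ = Real.log ‖P.eval 1‖ + Λ * (z.re - 1) + M := by
            rw [Real.log_mul hP1.ne' (Real.exp_pos _).ne', Real.log_exp]; ring
  have hmono := Real.circleAverage_mono hint1 hint2 hle
  rw [circleAverage_affine_re, circleAverage_log_norm_eval h1 hR] at hmono
  linarith

/-- **Jensen's bound from a tilted majorant.**  If `P(1) ≠ 0`, `R > 0` and
`‖P(z)‖ ≤ ‖P(1)‖ exp(Λ Re(z−1) + M)` on the circle `‖z − 1‖ = R`, then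
`Σ_{ρ ∈ roots P} log⁺ (R/‖1−ρ‖) ≤ M`: the circle average of `log ‖P‖` is at most
`log ‖P(1)‖ + M` because the harmonic term averages to zero.  (Reduced to the non-degenerate case
by rescaling `P ↦ cP`, `c > 0`, which preserves the hypothesis and the roots.) [folklore] -/
private theorem sum_posLog_le {P : ℂ[X]} (h1 : P.eval 1 ≠ 0) {R Λ M : ℝ} (hR : 0 < R)
    (hb : ∀ z : ℂ, ‖z - 1‖ = R → ‖P.eval z‖ ≤ ‖P.eval 1‖ * Real.exp (Λ * (z.re - 1) + M)) :
    (P.roots.map fun ρ => Real.posLog (R * ‖1 - ρ‖⁻¹)).sum ≤ M := by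
  have hP1 : 0 < ‖P.eval 1‖ := norm_pos_iff.2 h1
  -- rescale so that `log ‖Q(1)‖ = |Λ| R - M`
  set c : ℝ := Real.exp (|Λ| * R - M) / ‖P.eval 1‖ with hc
  have hcpos : 0 < c := div_pos (Real.exp_pos _) hP1
  have hc0 : (c : ℂ) ≠ 0 := by exact_mod_cast hcpos.ne'
  set Q : ℂ[X] := C (c : ℂ) * P with hQ
  have hQeval : ∀ z : ℂ, ‖Q.eval z‖ = c * ‖P.eval z‖ := by
    intro z
    rw [hQ, eval_C_mul, norm_mul, Complex.norm_of_nonneg hcpos.le]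
  have hQ1 : ‖Q.eval 1‖ = Real.exp (|Λ| * R - M) := by
    rw [hQeval, hc, div_mul_cancel₀ _ hP1.ne']
  have hQ1ne : Q.eval 1 ≠ 0 := by
    rw [← norm_pos_iff, hQ1]; exact Real.exp_pos _
  have hroots : Q.roots = P.roots := by rw [hQ, roots_C_mul _ hc0]
  rw [← hroots]
  refine sum_posLog_le_of_nonneg hQ1ne hR (Λ := Λ) ?_ ?_
  · intro z hz
    rw [hQ1, Real.log_exp]
    have hre : |z.re - 1| ≤ R := by
      have := abs_re_le_norm (z - 1)
      rw [sub_re, one_re] at this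
      linarith
    have : |Λ * (z.re - 1)| ≤ |Λ| * R := by
      rw [abs_mul]; exact mul_le_mul_of_nonneg_left hre (abs_nonneg _)
    have := neg_abs_le (Λ * (z.re - 1))
    linarith
  · intro z hz
    rw [hQeval, hQeval]
    rw [mul_assoc]
    exact mul_le_mul_of_nonneg_left (hb z hz) hcpos.le

/-- **Counting from the Jensen sum.**  If `P(1) ≠ 0` and `t` is real, the number of roots of `P`
with `‖1 − ρ‖ ≤ t` (with multiplicity) is at most `Σ_{ρ ∈ roots P} log⁺ (et/‖1−ρ‖)`: each such
root has `0 < ‖1 − ρ‖ ≤ t` and contributes at least `log e = 1`, the others contribute `≥ 0`.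
[folklore] -/
private theorem card_filter_le_sum_posLog {P : ℂ[X]} (h1 : P.eval 1 ≠ 0) (t : ℝ) :
    ((P.roots.filter fun ρ : ℂ => ‖(1 : ℂ) - ρ‖ ≤ t).card : ℝ) ≤
      (P.roots.map fun ρ => Real.posLog (Real.exp 1 * t * ‖1 - ρ‖⁻¹)).sum := by
  have hP : P ≠ 0 := fun h => h1 (by simp [h])
  have hge1 : ∀ x ∈ (P.roots.filter fun ρ : ℂ => ‖(1 : ℂ) - ρ‖ ≤ t).map
      (fun ρ => Real.posLog (Real.exp 1 * t * ‖1 - ρ‖⁻¹)), (1 : ℝ) ≤ x := by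
    intro x hx
    rw [Multiset.mem_map] at hx
    obtain ⟨ρ, hρ, rfl⟩ := hx
    rw [Multiset.mem_filter] at hρ
    obtain ⟨hρS, hρt⟩ := hρ
    have hroot : IsRoot P ρ := (mem_roots hP).1 hρS
    have hρ1 : ρ ≠ 1 := by rintro rfl; exact h1 hroot
    have hd : 0 < ‖(1 : ℂ) - ρ‖ := norm_pos_iff.2 (sub_ne_zero.2 hρ1.symm)
    have hx : Real.exp 1 ≤ Real.exp 1 * t * ‖1 - ρ‖⁻¹ := by
      rw [mul_assoc, le_mul_iff_one_le_right (Real.exp_pos 1), le_mul_inv_iff₀ hd, one_mul]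
      exact hρt
    calc (1 : ℝ) = Real.log (Real.exp 1) := (Real.log_exp 1).symm
      _ ≤ Real.log (Real.exp 1 * t * ‖1 - ρ‖⁻¹) := Real.log_le_log (Real.exp_pos 1) hx
      _ ≤ Real.posLog (Real.exp 1 * t * ‖1 - ρ‖⁻¹) := le_max_right _ _
  have hcard := Multiset.card_nsmul_le_sum hge1
  rw [Multiset.card_map, nsmul_eq_mul, mul_one] at hcard
  have hsplit := congrArg (fun S : Multiset ℂ =>
      (S.map fun ρ => Real.posLog (Real.exp 1 * t * ‖1 - ρ‖⁻¹)).sum)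
    (Multiset.filter_add_not (fun ρ : ℂ => ‖(1 : ℂ) - ρ‖ ≤ t) P.roots)
  simp only [Multiset.map_add, Multiset.sum_add] at hsplit
  have hnonneg : 0 ≤ ((P.roots.filter fun ρ : ℂ => ¬ ‖(1 : ℂ) - ρ‖ ≤ t).map
      (fun ρ => Real.posLog (Real.exp 1 * t * ‖1 - ρ‖⁻¹))).sum :=
    Multiset.sum_nonneg fun x hx => by
      rw [Multiset.mem_map] at hx
      obtain ⟨ρ, _, rfl⟩ := hx
      exact Real.posLog_nonneg
  linarith

/-- `2^{3/2} ≤ 3` (indeed `2^{3/2} = 2√2 ≈ 2.83`; squared: `8 ≤ 9`). [folklore] -/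
private theorem two_rpow_three_halves_le_three : (2 : ℝ) ^ (3 / 2 : ℝ) ≤ 3 := by
  have h0 : (0 : ℝ) ≤ (2 : ℝ) ^ (3 / 2 : ℝ) := Real.rpow_nonneg (by norm_num) _
  have hsq : ((2 : ℝ) ^ (3 / 2 : ℝ)) ^ (2 : ℕ) = 8 := by
    rw [← Real.rpow_natCast, ← Real.rpow_mul (by norm_num : (0 : ℝ) ≤ 2)]
    norm_num
  nlinarith [hsq, h0]

/-- **Stub 3 of the line `jensen-stieltjes-majorant` (pure complex analysis: Jensen at the free
centre, counting form).**  Let `P ∈ ℂ[z]` with `P(1) ≠ 0`, `Λ, Λ', A, B ≥ 0`, `R₁ ≥ 1`.  Suppose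
the DISC majorant `‖P(z)‖ ≤ ‖P(1)‖ exp(Λ Re(z−1) + A(1+‖z−1‖)^{3/2})` on `‖z−1‖ ≤ R₁` (harmonic
exponent) and the GLOBAL majorant `‖P(z)‖ ≤ ‖P(1)‖ exp(Λ'(1+‖z−1‖) + B(1+‖z−1‖)^{3/2})`
everywhere.  Then, with `N(t) = #{ρ ∈ roots P : ‖1−ρ‖ ≤ t}` (multiplicity counted):
(a) zero-free disc: every root has `‖1 − ρ‖ ≥ e^{−3A}`;
(b) near count: `N(t) ≤ A(1 + et)^{3/2}` whenever `0 < t`, `et ≤ R₁`;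
(c) global count: `N(t) ≤ (Λ + Λ')(1 + et) + B(1 + et)^{3/2}` for all `t > 0`.
Proof: Jensen's formula for `z ↦ P(z)` on `‖z − 1‖ = R` in multiset form
(`Σ_ρ log⁺(R/‖1−ρ‖) = ⨍ log‖P‖ − log‖P(1)‖`), the vanishing of the circle average of the
harmonic term `Λ Re(z−1)`, and monotonicity of circle averages give
`Σ_ρ log⁺(R/‖1−ρ‖) ≤ A(1+R)^{3/2}` for `R ≤ R₁`, resp. `≤ Λ'(1+R) + B(1+R)^{3/2}` for all `R`;
take `R = et` (each counted root weighs `≥ 1`) for (b), (c) and `R = 1` (`2^{3/2} ≤ 3`) for (a). -/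
theorem stub_jensenCount :
    ∀ (P : Polynomial ℂ) (Λ Λ' R₁ A B : ℝ), P.eval 1 ≠ 0 → 0 ≤ Λ → 0 ≤ Λ' → 1 ≤ R₁ → 0 ≤ A → 0 ≤ B →
      (∀ z : ℂ, ‖z - 1‖ ≤ R₁ →
        ‖P.eval z‖ ≤ ‖P.eval 1‖ * Real.exp (Λ * (z.re - 1) + A * (1 + ‖z - 1‖) ^ (3 / 2 : ℝ))) →
      (∀ z : ℂ, ‖P.eval z‖ ≤ ‖P.eval 1‖ * Real.exp (Λ' * (1 + ‖z - 1‖) + B * (1 + ‖z - 1‖) ^ (3 / 2 : ℝ))) →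
      (∀ ρ ∈ P.roots, Real.exp (-(3 * A)) ≤ ‖(1 : ℂ) - ρ‖) ∧
      (∀ t : ℝ, 0 < t → Real.exp 1 * t ≤ R₁ →
        ((P.roots.filter fun ρ : ℂ => ‖(1 : ℂ) - ρ‖ ≤ t).card : ℝ) ≤ A * (1 + Real.exp 1 * t) ^ (3 / 2 : ℝ)) ∧
      (∀ t : ℝ, 0 < t →
        ((P.roots.filter fun ρ : ℂ => ‖(1 : ℂ) - ρ‖ ≤ t).card : ℝ) ≤
          (Λ + Λ') * (1 + Real.exp 1 * t) + B * (1 + Real.exp 1 * t) ^ (3 / 2 : ℝ)) := by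
  intro P Λ Λ' R₁ A B hP1 hΛ hΛ' hR₁ hA hB hdisc hglob
  have hP : P ≠ 0 := fun h => hP1 (by simp [h])
  -- Jensen sums from the disc majorant (`R ≤ R₁`) and from the global majorant (all `R`)
  have keyDisc : ∀ R : ℝ, 0 < R → R ≤ R₁ →
      (P.roots.map fun ρ => Real.posLog (R * ‖1 - ρ‖⁻¹)).sum ≤ A * (1 + R) ^ (3 / 2 : ℝ) := by
    intro R hR hRR₁
    refine sum_posLog_le hP1 hR (Λ := Λ) fun z hz => ?_
    have h := hdisc z (hz.le.trans hRR₁)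
    rwa [hz] at h
  have keyGlob : ∀ R : ℝ, 0 < R →
      (P.roots.map fun ρ => Real.posLog (R * ‖1 - ρ‖⁻¹)).sum ≤
        Λ' * (1 + R) + B * (1 + R) ^ (3 / 2 : ℝ) := by
    intro R hR
    refine sum_posLog_le hP1 hR (Λ := 0) fun z hz => ?_
    have h := hglob z
    rw [hz] at h
    simpa using h
  refine ⟨?_, ?_, ?_⟩
  · -- (a) the zero-free disc, from Jensen on `‖z - 1‖ = 1`
    intro ρ hρ
    have hroot : IsRoot P ρ := (mem_roots hP).1 hρ
    have hρ1 : ρ ≠ 1 := by rintro rfl; exact hP1 hroot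
    have hd : 0 < ‖(1 : ℂ) - ρ‖ := norm_pos_iff.2 (sub_ne_zero.2 hρ1.symm)
    have hJ := keyDisc 1 one_pos hR₁
    have hterm : Real.posLog (1 * ‖1 - ρ‖⁻¹) ≤
        (P.roots.map fun ρ => Real.posLog (1 * ‖1 - ρ‖⁻¹)).sum :=
      Multiset.single_le_sum (fun x hx => by
        rw [Multiset.mem_map] at hx
        obtain ⟨σ, _, rfl⟩ := hx
        exact Real.posLog_nonneg) _ (Multiset.mem_map_of_mem _ hρ)
    have h3 : A * (1 + 1) ^ (3 / 2 : ℝ) ≤ 3 * A := by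
      rw [show (1 : ℝ) + 1 = 2 by norm_num, mul_comm]
      exact mul_le_mul_of_nonneg_right two_rpow_three_halves_le_three hA
    have hlog : Real.log (‖(1 : ℂ) - ρ‖⁻¹) ≤ 3 * A := by
      have h := le_max_right 0 (Real.log (‖(1 : ℂ) - ρ‖⁻¹))
      rw [← Real.posLog_apply] at h
      rw [one_mul] at hterm
      linarith
    rw [Real.log_inv] at hlog
    exact (Real.le_log_iff_exp_le hd).1 (by linarith)
  · -- (b) the near count, from Jensen on `‖z - 1‖ = et ≤ R₁`
    intro t ht het
    have hR : 0 < Real.exp 1 * t := mul_pos (Real.exp_pos 1) ht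
    exact (card_filter_le_sum_posLog hP1 t).trans (keyDisc _ hR het)
  · -- (c) the global count, from Jensen on `‖z - 1‖ = et` and the global majorant
    intro t ht
    have hR : 0 < Real.exp 1 * t := mul_pos (Real.exp_pos 1) ht
    refine (card_filter_le_sum_posLog hP1 t).trans ((keyGlob _ hR).trans ?_)
    have : 0 ≤ Λ * (1 + Real.exp 1 * t) := mul_nonneg hΛ (by positivity)
    nlinarith

end Summit.Parity.BatemanHorn.Cruxes.LinearCappedRepulsion.JensenStieltjesMajorant

end
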